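import Summits.QuantumFields.BalabanUV.T4Continuum.Support.DirichletStarSlabMode
import Summits.QuantumFields.BalabanUV.T4Continuum.Support.DirichletStarClassPoincare
import Summits.QuantumFields.BalabanUV.T4Continuum.Support.RegionGaugeFixedVectorTop
import Summits.QuantumFields.BalabanUV.Beta.GAN24.DirichletBoxTwoLevel

/-!
# T⁴ programme, spine node NE2 (U1a), sub-row Δ1 «NE2⁰-Dirichlet» — THE OUTER NORMAL LAYER OF THE ONE-BLOCK SLAB AND THE
# RENORMALISED PLANTING: the slab normal mode splits as `slabA = ρ + χ` (interior normal bonds = REGULAR coarse indices, `nch = L^d`;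
# the outer normal layer `χ` = DEFICIENT coarse indices, `nch = L^{d−1}`), and the owner's renormalised injection `J̃` plants it as
# `J̃·slabA_k = (√(L^d))⁻¹·(slabA_{k+1} + (√L − 1)·χ_{k+1})` — the outer layer is AMPLIFIED by `√L`

NE2 formalisation swarm `b2b-balaban-t4-ne2-formalise-*`, LEAF PROVER 02 (gen 7), supplier item «Δ1-VEC-W3̃-SLAB-NOGO» (owner ruling R29
successor item (iii) «W3/W3̃ two-level injected laws for the star towers», NEGATIVE side), file 1 of 3.  On the owner's (t4-ne2-p1 gen 13)
`Support/DirichletStarSlabMode` (p228269: the one-block slab `slabS M i`, its star `i`-bonds `star_slab_iff`, the mode `slabA`,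
`curlR_slabA = 0`, `gradR_conjTranspose_slabA = 0`, the column count `sum_coord`, `nsq_slabA_le`), `Support/DirichletSubregionRenormTower`
(p228571: `nch`, `JnR`) and leaf-07-g7's `Support/DirichletStarSiblingClasses` (p229650: `card_cube : L^d = mult·nch`, `mult ∈ {1, L}`):

 * §1 curl-free normal profiles: any field `[ν = i]·f(x_i)` has zero torus curl (`CurlOp_mulVec_profile`);
 * §2 THE OUTER NORMAL LAYER `chi n M i` (= `1` on the star `i`-bonds `(x,i)` with `x ∉ Ω`, i.e. `(x_i).val = n·M_i − 1`) and the FIRST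
   INTERIOR LAYER `psi n M i` (= `1` on the sites `x ∈ Ω` with `(x_i).val = 0`): `ext_chi`, **`curlR_chi = 0`**,
   **`gradR_conjTranspose_chi : ∂_Ωᴴ χ = n·ψ`** (the layer charge);
 * §3 counts: `nsq chi = nsq psi = #columns`, `#columns (L·n) = L^{d−1}·#columns (n)`; the slab IS a coordinate box (`isCoordBox_slabS`);
 * §4 along the tower `n_k = L^k`: `JnR_mulVec_apply`, the class sizes `nch = L^d` (parent site in `Ω_k`) ∕ `L^{d−1}` (parent site
   outside), and the PLANTING IDENTITIES **`JnR_chi : J̃_k χ_k = (√(L^{d−1}))⁻¹ χ_{k+1}`**,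
   **`JnR_slabA : J̃_k slabA_k = (√(L^d))⁻¹·(slabA_{k+1} + (√L − 1)·χ_{k+1})`**.

Files 2–3 (`Support/DirichletStarSlabLayerEnergy`, `Support/DirichletStarRenormSlabNoGo`; tools `Support/RegionNormPairingTools`) turn this into a KERNEL NO-GO: the renormalised
injected law W3̃ displayed in `DirichletStarRenormTower.towerLimitRate_star_renorm_of_sq` cannot hold at any geometric rate faster than
`(√L)⁻¹` on the slab.

HONEST FRAMING (T4-DAG p. 1).  Lattice geometry and bookkeeping at MODEL level (`U = 1`, ONE region — the one-block slab —, ONE averaging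
scale, finite torus); statements / conventions OURS ([folklore]); nothing analytic is discharged here; NE2 (U1a) NOT proved; spine 0/9 unchanged;
NOT [B9] (3.16)/(3.23)–(3.27) as printed; NOT infinite volume, NOT a mass gap, NOT the Clay problem, NOT summit progress.  HONEST DEPENDENCY:
continuum YM on T⁴ ⇐ BetaPertH ∧ nine spine estimates (0/9 proved); BetaPertH ⇐ (D1) ∧ (D4) ∧ CAP+tail; G-an2-4 gates asym, D1 and NE2/3/4.
No `sorry`.
-/

noncomputable section

open scoped BigOperators ComplexConjugate Matrix Matrix.Norms.L2Operator
open Finset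

namespace Summit.QuantumFields.BalabanUV.T4Continuum.DirichletStarSlabLayer

open Literature.MathematicalPhysics.QuantumFieldTheory.Balaban1983to89.B5Prop11Plancherel (Tor fine unitVec)
open Literature.MathematicalPhysics.QuantumFieldTheory.Balaban1983to89.B5Prop11Lower (nsq nsq_nonneg)
open Literature.MathematicalPhysics.QuantumFieldTheory.Balaban1983to89.B5G183RateUnitTower (lev)
open Literature.MathematicalPhysics.QuantumFieldTheory.Balaban1983to89.B5Action121 (GradOp CurlOp CurlOp_mulVec Fs_apply
  GradOp_conjTranspose_mulVec_eq divS_apply)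
open Summit.QuantumFields.BalabanUV.T4Continuum
open Summit.QuantumFields.BalabanUV.T4Continuum.BalabanAveragedTowerUnit (idx lev_succ')
open Summit.QuantumFields.BalabanUV.T4Continuum.BalabanAveragedTowerModes (par)
open Summit.QuantumFields.BalabanUV.T4Continuum.BlockPairingGeometry (parT)
open Summit.QuantumFields.BalabanUV.T4Continuum.SubtypeCompression (ext ext_apply_of ext_apply_of_not nsq_ext)
open Summit.QuantumFields.BalabanUV.T4Continuum.ScalarBlockPoincare (nsq_smul)
open Summit.QuantumFields.BalabanUV.T4Continuum.RegionGaugeFixedVector (starReg curlR gradR avgR regionDeltaA)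
open Summit.QuantumFields.BalabanUV.T4Continuum.RegionGaugeSliceTorus (curlR_mulVec gradR_conjTranspose_mulVec)
open Summit.QuantumFields.BalabanUV.T4Continuum.DirichletSubregionTowerOf (pidx)
open Summit.QuantumFields.BalabanUV.T4Continuum.DirichletSubregionRenormTower (nch JnR)
open Summit.QuantumFields.BalabanUV.T4Continuum.DirichletStarVectorTower (starP star_down blockReg_par_iff)
open Summit.QuantumFields.BalabanUV.T4Continuum.DirichletStarSiblingClasses (mult card_cube)
open Summit.QuantumFields.BalabanUV.T4Continuum.DirichletStarClassPoincare (prt)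
open Summit.QuantumFields.BalabanUV.T4Continuum.DirichletStarSlabMode
open Summit.QuantumFields.BalabanUV.Beta.GAN24.DirichletBoxTrace (blockReg)
open Summit.QuantumFields.BalabanUV.Beta.GAN24.DirichletBoxTwoLevel (IsCoordBox)

variable {d : ℕ} (n : ℕ) [NeZero n] (M : Fin d → ℕ) [hM : ∀ μ, NeZero (M μ)] (i : Fin d)

/-! ## §1 Normal profiles are curl-free -/

/-- **a field `[ν = i]·f(x_i)` (an `i`-component depending on the `i`-coordinate only) has zero torus curl**: a tangential step does not move
the normal coordinate. [cite: Balaban1984PropagatorsI, (1.2) p.18 (shape)] [folklore] -/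
theorem CurlOp_mulVec_profile (c : ℂ) (f : ZMod (fine n M i) → ℂ) :
    CurlOp (fine n M) c *ᵥ (fun b : Tor (fine n M) × Fin d => if b.2 = i then f (b.1 i) else 0) = 0 := by
  funext ⟨x, μ, ν⟩
  rw [CurlOp_mulVec, Fs_apply, Pi.zero_apply]
  by_cases hμ : μ = i
  · subst hμ
    by_cases hν : ν = μ
    · subst hν; simp
    · simp only [if_true, if_neg hν, add_unitVec_apply_of_ne n M μ x hν]; ring
  · by_cases hν : ν = i
    · subst hν; simp only [if_neg hμ, if_true, add_unitVec_apply_of_ne n M ν x hμ]; ring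
    · simp only [if_neg hμ, if_neg hν]; ring

/-! ## §2 The outer normal layer `χ` and the first interior layer `ψ` -/

/-- THE OUTER NORMAL LAYER: `1` on the star `i`-bonds whose site lies OUTSIDE `Ω` (the inward bonds from the last torus layer — the
DEFICIENT coarse indices of the renormalised pairing), `0` elsewhere. [folklore] -/
def chi : {b // starReg n M (slabS M i) b} → ℂ := fun b => if b.1.2 = i ∧ ¬ blockReg n M (slabS M i) b.1.1 then 1 else 0

/-- THE FIRST INTERIOR LAYER (as a Dirichlet scalar on `Ω`): `1` on the sites with `(x_i).val = 0`. [folklore] -/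
def psi : {x // blockReg n M (slabS M i) x} → ℂ := fun x => if (x.1 i).val = 0 then 1 else 0

/-- the layer profile `[t.val = n·M_i − 1]`. [folklore] -/
def layF (t : ZMod (fine n M i)) : ℂ := if t.val = fine n M i - 1 then 1 else 0

/-- a star `i`-bond lies outside `Ω` iff its `i`-coordinate is `n·M_i − 1`. [folklore] -/
theorem not_blockReg_iff_of_star (hMi : 3 ≤ M i) {x : Tor (fine n M)} (hx : starReg n M (slabS M i) (x, i)) :
    ¬ blockReg n M (slabS M i) x ↔ (x i).val = fine n M i - 1 := by
  have h3 := three_mul_le n M i hMi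
  have hn : 1 ≤ n := Nat.pos_of_ne_zero (NeZero.ne n)
  rw [blockReg_slab_iff]
  have h := (star_slab_iff n M i hMi x).mp hx
  omega

/-- **the zero-extension of `χ` is the layer profile on the `i`-components**. [folklore] -/
theorem ext_chi (hMi : 3 ≤ M i) :
    ext (starReg n M (slabS M i)) (chi n M i) = fun b => if b.2 = i then layF n M i (b.1 i) else 0 := by
  have h3 := three_mul_le n M i hMi
  have hn : 1 ≤ n := Nat.pos_of_ne_zero (NeZero.ne n)
  funext ⟨x, μ⟩
  by_cases hs : starReg n M (slabS M i) (x, μ)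
  · rw [show ext (starReg n M (slabS M i)) (chi n M i) (x, μ) = chi n M i ⟨(x, μ), hs⟩ from ext_apply_of _ _ ⟨(x, μ), hs⟩]
    simp only [chi]
    by_cases hμ : μ = i
    · subst hμ
      rw [if_pos rfl, layF]
      by_cases hb : blockReg n M (slabS M μ) x
      · rw [if_neg (fun h => h.2 hb), if_neg]
        rw [blockReg_slab_iff] at hb; omega
      · rw [if_pos ⟨rfl, hb⟩, if_pos ((not_blockReg_iff_of_star n M μ hMi hs).mp hb)]
    · rw [if_neg (fun h => hμ h.1), if_neg hμ]
  · rw [ext_apply_of_not _ _ hs]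
    by_cases hμ : μ = i
    · subst hμ
      simp only [if_true]
      rw [layF, if_neg]
      intro h
      exact hs ((star_slab_iff n M μ hMi x).mpr (Or.inr h))
    · simp only [hμ, if_false]

/-- **`curl χ = 0`**. [cite: Balaban1984PropagatorsI, (1.2) p.18 (shape)] [folklore] -/
theorem curlR_chi (hMi : 3 ≤ M i) : curlR n M (slabS M i) *ᵥ chi n M i = 0 := by
  rw [curlR_mulVec, ext_chi n M i hMi, CurlOp_mulVec_profile, smul_zero]

/-- the layer profile one step below a site `t`: `layF (t − 1) = [t.val = 0]`. [folklore] -/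
theorem layF_sub_one (hMi : 3 ≤ M i) (t : ZMod (fine n M i)) : layF n M i (t - 1) = if t.val = 0 then 1 else 0 := by
  have h3 := three_mul_le n M i hMi
  have hn : 1 ≤ n := Nat.pos_of_ne_zero (NeZero.ne n)
  have hN : 1 < fine n M i := by omega
  haveI : Fact (1 < fine n M i) := ⟨hN⟩
  unfold layF
  by_cases ht : t.val = 0
  · rw [if_pos ht, if_pos]
    have ht0 : t = 0 := by rw [← ZMod.val_eq_zero]; exact ht
    rw [ht0, zero_sub, ZMod.val_neg_of_ne_zero, ZMod.val_one]
  · rw [if_neg ht, if_neg]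
    intro h
    have e : (t - 1).val + 1 = fine n M i := by omega
    have e2 : t - 1 + 1 = 0 := by
      have : ((t - 1).val : ZMod (fine n M i)) + ((1 : ℕ) : ZMod (fine n M i)) = ((fine n M i : ℕ) : ZMod (fine n M i)) := by
        rw [← Nat.cast_add, e]
      rwa [ZMod.natCast_zmod_val, Nat.cast_one, ZMod.natCast_self] at this
    rw [sub_add_cancel] at e2
    exact ht (by rw [e2, ZMod.val_zero])

/-- **THE LAYER CHARGE**: `∂_Ωᴴ χ = n·ψ` — at a first-layer site the inward bond from outside carries `1` and the outward bond `0`; at every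
other site of the slab both normal bonds carry `0`. [cite: Balaban1984PropagatorsI, (1.21) p.21 (shape: ∂*)] [folklore] -/
theorem gradR_conjTranspose_chi (hMi : 3 ≤ M i) :
    (gradR n M (slabS M i))ᴴ *ᵥ chi n M i = fun x => (n : ℂ) * psi n M i x := by
  have h3 := three_mul_le n M i hMi
  have hn : 1 ≤ n := Nat.pos_of_ne_zero (NeZero.ne n)
  rw [gradR_conjTranspose_mulVec, ext_chi n M i hMi]
  funext ⟨x, hx⟩
  show ((GradOp (fine n M) (n : ℂ))ᴴ *ᵥ _) x = _
  rw [GradOp_conjTranspose_mulVec_eq, divS_apply]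
  rw [Finset.sum_eq_single i]
  · have hxn : (x i).val < n := (blockReg_slab_iff n M i x).mp hx
    have h1 : layF n M i (x i) = 0 := by unfold layF; rw [if_neg]; omega
    have h2 : (x - unitVec (fine n M) i) i = x i - 1 := by simp [unitVec]
    simp only [if_true, h2, layF_sub_one n M i hMi, h1, sub_zero, Complex.conj_natCast, psi]
  · intro μ _ hμ
    rw [if_neg hμ, if_neg hμ, sub_self, mul_zero]
  · intro h; exact absurd (Finset.mem_univ _) h

/-- `slabA = ρ + χ` with `ρ = slabA − χ` the INTERIOR normal bonds: `(slabA − χ) b = [b.2 = i ∧ b.1 ∈ Ω]`. [folklore] -/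
theorem slabA_sub_chi_apply (b : {b // starReg n M (slabS M i) b}) :
    slabA n M i b - chi n M i b = if b.1.2 = i ∧ blockReg n M (slabS M i) b.1.1 then 1 else 0 := by
  simp only [slabA, chi]
  by_cases h1 : b.1.2 = i
  · by_cases h2 : blockReg n M (slabS M i) b.1.1
    · rw [if_pos h1, if_neg (fun h => h.2 h2), if_pos ⟨h1, h2⟩, sub_zero]
    · rw [if_pos h1, if_pos ⟨h1, h2⟩, if_neg (fun h => h2 h.2), sub_self]
  · rw [if_neg h1, if_neg (fun h => h1 h.1), if_neg (fun h => h1 h.1), sub_zero]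

/-! ## §3 Counts -/

/-- the number of `i`-columns of the fine torus. [folklore] -/
abbrev col : ℕ := Fintype.card ((j : {j : Fin d // j ≠ i}) → ZMod (fine n M j))

/-- exactly one residue has value `v` (`v < N`): `Σ_t [t.val = v] = 1`. [folklore] -/
theorem sum_ite_val_eq {N : ℕ} [NeZero N] {v : ℕ} (hv : v < N) :
    ∑ t : ZMod N, (if t.val = v then (1 : ℝ) else 0) = 1 := by
  have e : ∀ t : ZMod N, (t.val = v) ↔ (t = ((v : ℕ) : ZMod N)) := by
    intro t
    constructor
    · intro h; rw [← h, ZMod.natCast_zmod_val]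
    · intro h; rw [h, ZMod.val_natCast, Nat.mod_eq_of_lt hv]
  simp_rw [e]
  rw [Finset.sum_ite_eq' Finset.univ ((v : ℕ) : ZMod N) (fun _ => (1 : ℝ)), if_pos (Finset.mem_univ _)]

/-- **`nsq χ = #columns`** (one outer bond per column). [folklore] -/
theorem nsq_chi (hMi : 3 ≤ M i) : nsq (chi n M i) = (col n M i : ℝ) := by
  have h3 := three_mul_le n M i hMi
  have hn : 1 ≤ n := Nat.pos_of_ne_zero (NeZero.ne n)
  rw [← nsq_ext (starReg n M (slabS M i)) (chi n M i), ext_chi n M i hMi, nsq, Fintype.sum_prod_type]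
  have e : ∀ x : Tor (fine n M), ∑ μ : Fin d, ‖(if μ = i then layF n M i (x i) else 0 : ℂ)‖ ^ 2
      = (if (x i).val = fine n M i - 1 then (1 : ℝ) else 0) := by
    intro x
    rw [Finset.sum_eq_single i]
    · rw [if_pos rfl, layF]; split_ifs <;> simp
    · intro μ _ hμ; rw [if_neg hμ, norm_zero, zero_pow two_ne_zero]
    · intro h; exact absurd (Finset.mem_univ _) h
  rw [Finset.sum_congr rfl (fun x _ => e x), sum_coord n M i (fun t => if t.val = fine n M i - 1 then (1 : ℝ) else 0),
    sum_ite_val_eq (by omega), mul_one]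

/-- **`nsq ψ = #columns`** (one first-layer site per column). [folklore] -/
theorem nsq_psi (hMi : 3 ≤ M i) : nsq (psi n M i) = (col n M i : ℝ) := by
  have h3 := three_mul_le n M i hMi
  have hn : 1 ≤ n := Nat.pos_of_ne_zero (NeZero.ne n)
  unfold nsq
  have e1 : ∑ x : {x // blockReg n M (slabS M i) x}, ‖psi n M i x‖ ^ 2
      = ∑ x : Tor (fine n M), (if (x i).val = 0 then (1 : ℝ) else 0) := by
    rw [← Fintype.sum_subtype_add_sum_subtype (blockReg n M (slabS M i)) (fun x : Tor (fine n M) => if (x i).val = 0 then (1 : ℝ) else 0)]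
    have h0 : ∑ x : {x // ¬ blockReg n M (slabS M i) x}, (if (x.1 i).val = 0 then (1 : ℝ) else 0) = 0 := by
      refine Finset.sum_eq_zero fun x _ => ?_
      rw [if_neg]
      intro h
      exact x.2 ((blockReg_slab_iff n M i x.1).mpr (by omega))
    rw [h0, add_zero]
    refine Finset.sum_congr rfl fun x _ => ?_
    simp only [psi]; split_ifs <;> simp
  rw [e1, sum_coord n M i (fun t => if t.val = 0 then (1 : ℝ) else 0), sum_ite_val_eq (by omega), mul_one]

omit [NeZero n] in
/-- the one-block slab IS a coordinate box (`IsCoordBox`, road P2 / leaf-07-g7's `towerLimitRate_star_renorm_box_of_slice`): the no-go lives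
inside the box class. [folklore] -/
theorem isCoordBox_slabS : IsCoordBox M (slabS M i) := by
  classical
  refine ⟨fun μ => if μ = i then {0} else Finset.univ, fun b => ?_⟩
  constructor
  · intro hb μ
    dsimp only
    split_ifs with hμ
    · subst hμ; exact Finset.mem_singleton.mpr hb
    · exact Finset.mem_univ _
  · intro h
    have h1 := h i
    dsimp only at h1
    rw [if_pos rfl] at h1
    exact Finset.mem_singleton.mp h1

/-! ## §4 Along the tower: the renormalised planting of the slab mode -/

section Tower

variable (L : ℕ) [NeZero L] (S : Tor M → Prop) [DecidablePred S]

/-- `J̃` plants the parent's value with weight `(nch)^{−1/2}`: `(J̃_k v) y = (√(nch (parT y)))⁻¹ · v (parT y)`. [folklore] -/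
theorem JnR_mulVec_apply (k : ℕ) (v : pidx L M (starP L M S) k → ℂ) (y : pidx L M (starP L M S) (k + 1)) :
    (JnR L M (starP L M S) k *ᵥ v) y
      = (((Real.sqrt (nch L M (starP L M S) k (prt L M S k y).1))⁻¹ : ℝ) : ℂ) * v (prt L M S k y) := by
  simp only [Matrix.mulVec, dotProduct, JnR]
  rw [Finset.sum_eq_single (prt L M S k y)]
  · rw [if_pos (show parT (lev L k) L M y.1 = (prt L M S k y).1 from rfl)]
  · intro i' _ hi
    rw [if_neg, zero_mul]
    intro h
    exact hi (Subtype.ext h).symm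
  · intro h; exact absurd (mem_univ _) h

/-- **CLASS SIZES**: `nch = L^d` when the parent site lies in `Ω_k` (full block), `nch = L^{d−1}` otherwise (last `ν`-layer). [folklore] -/
theorem nch_eq (k : ℕ) (i' : pidx L M (starP L M S) k) :
    (nch L M (starP L M S) k i'.1 : ℝ) = if blockReg (lev L k) M S i'.1.1 then (L : ℝ) ^ d else (L : ℝ) ^ (d - 1) := by
  have hc := card_cube L M S k i'
  rw [Fintype.card_pi, Finset.prod_const, Fintype.card_fin, Finset.card_univ, Fintype.card_fin] at hc
  unfold mult at hc
  by_cases hb : blockReg (lev L k) M S i'.1.1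
  · rw [if_pos hb] at hc; rw [if_pos hb, one_mul] at *; exact_mod_cast hc.symm
  · rw [if_neg hb] at hc; rw [if_neg hb]
    have hL : 0 < L := Nat.pos_of_ne_zero (NeZero.ne L)
    have hd : 0 < d := Fin.pos i'.1.2
    have e : L * L ^ (d - 1) = L * nch L M (starP L M S) k i'.1 := by
      rw [← pow_succ', Nat.sub_add_cancel hd]; exact hc
    have e2 := Nat.eq_of_mul_eq_mul_left hL e
    exact_mod_cast e2.symm

end Tower

section SlabTower

variable (L : ℕ) [NeZero L]

/-- **refining by `L` multiplies the number of columns by `L^{d−1}`**. [folklore] -/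
theorem col_mul : (col (L * n) M i : ℝ) = (L : ℝ) ^ (d - 1) * (col n M i : ℝ) := by
  simp only [col, Fintype.card_pi, ZMod.card, fine]
  push_cast
  simp_rw [mul_assoc (L : ℝ)]
  rw [Finset.prod_mul_distrib, Finset.prod_const, Finset.card_univ]
  congr 2
  rw [Fintype.card_subtype_compl, Fintype.card_fin, Fintype.card_unique]

/-- **THE OUTER LAYER IS PLANTED ON THE OUTER LAYER, WITH WEIGHT `(√(L^{d−1}))⁻¹`**: `J̃_k χ_k = (√(L^{d−1}))⁻¹·χ_{k+1}`. [folklore] -/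
theorem JnR_chi (k : ℕ) :
    JnR L M (starP L M (slabS M i)) k *ᵥ chi (lev L k) M i
      = (((Real.sqrt ((L : ℝ) ^ (d - 1)))⁻¹ : ℝ) : ℂ) • chi (lev L (k + 1)) M i := by
  funext y
  rw [JnR_mulVec_apply, Pi.smul_apply, smul_eq_mul]
  have hpar : blockReg (lev L k) M (slabS M i) (prt L M (slabS M i) k y).1.1 ↔ blockReg (lev L (k + 1)) M (slabS M i) y.1.1 :=
    blockReg_par_iff L M (slabS M i) k y.1.1
  simp only [chi]
  have e2 : (prt L M (slabS M i) k y).1.2 = y.1.2 := rfl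
  rw [e2]
  by_cases h : y.1.2 = i ∧ ¬ blockReg (lev L (k + 1)) M (slabS M i) y.1.1
  · have h' : y.1.2 = i ∧ ¬ blockReg (lev L k) M (slabS M i) (prt L M (slabS M i) k y).1.1 := ⟨h.1, fun hb => h.2 (hpar.mp hb)⟩
    rw [if_pos h, if_pos h', nch_eq, if_neg h'.2]
  · have h' : ¬ (y.1.2 = i ∧ ¬ blockReg (lev L k) M (slabS M i) (prt L M (slabS M i) k y).1.1) :=
      fun hh => h ⟨hh.1, fun hb => hh.2 (hpar.mpr hb)⟩
    rw [if_neg h, if_neg h', mul_zero, mul_zero]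

/-- the interior normal bonds are planted on the interior normal bonds with weight `(√(L^d))⁻¹`. [folklore] -/
theorem JnR_slabA_sub_chi (k : ℕ) :
    JnR L M (starP L M (slabS M i)) k *ᵥ (slabA (lev L k) M i - chi (lev L k) M i)
      = (((Real.sqrt ((L : ℝ) ^ d))⁻¹ : ℝ) : ℂ) • (slabA (lev L (k + 1)) M i - chi (lev L (k + 1)) M i) := by
  funext y
  rw [JnR_mulVec_apply, Pi.smul_apply, smul_eq_mul, Pi.sub_apply, Pi.sub_apply, slabA_sub_chi_apply, slabA_sub_chi_apply]
  have hpar : blockReg (lev L k) M (slabS M i) (prt L M (slabS M i) k y).1.1 ↔ blockReg (lev L (k + 1)) M (slabS M i) y.1.1 :=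
    blockReg_par_iff L M (slabS M i) k y.1.1
  have e2 : (prt L M (slabS M i) k y).1.2 = y.1.2 := rfl
  rw [e2]
  by_cases h : y.1.2 = i ∧ blockReg (lev L (k + 1)) M (slabS M i) y.1.1
  · have h' : y.1.2 = i ∧ blockReg (lev L k) M (slabS M i) (prt L M (slabS M i) k y).1.1 := ⟨h.1, hpar.mpr h.2⟩
    rw [if_pos h, if_pos h', nch_eq, if_pos h'.2]
  · have h' : ¬ (y.1.2 = i ∧ blockReg (lev L k) M (slabS M i) (prt L M (slabS M i) k y).1.1) :=
      fun hh => h ⟨hh.1, hpar.mp hh.2⟩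
    rw [if_neg h, if_neg h', mul_zero, mul_zero]

omit [NeZero L] in
/-- `(√(L^{d−1}))⁻¹ = (√(L^d))⁻¹·√L` (`d ≥ 1`, `L ≥ 1`). [folklore] -/
theorem sqrt_pow_pred_inv (hL : 1 ≤ L) (hd : 0 < d) :
    (Real.sqrt ((L : ℝ) ^ (d - 1)))⁻¹ = (Real.sqrt ((L : ℝ) ^ d))⁻¹ * Real.sqrt L := by
  have hL0 : (0 : ℝ) < L := by exact_mod_cast hL
  have hs : Real.sqrt (L : ℝ) ≠ 0 := (Real.sqrt_pos.mpr hL0).ne'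
  have e : (L : ℝ) ^ d = (L : ℝ) ^ (d - 1) * L := by rw [← pow_succ, Nat.sub_add_cancel hd]
  rw [e, Real.sqrt_mul (pow_nonneg hL0.le _), mul_inv, mul_assoc, inv_mul_cancel₀ hs, mul_one]

/-- **THE RENORMALISED PLANTING OF THE SLAB MODE**: `J̃_k slabA_k = (√(L^d))⁻¹·(slabA_{k+1} + (√L − 1)·χ_{k+1})` — King's piecewise-constant
planting of the mode, with the OUTER NORMAL LAYER AMPLIFIED by `√L`. [folklore] -/
theorem JnR_slabA (k : ℕ) :
    JnR L M (starP L M (slabS M i)) k *ᵥ slabA (lev L k) M i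
      = (((Real.sqrt ((L : ℝ) ^ d))⁻¹ : ℝ) : ℂ) •
          (slabA (lev L (k + 1)) M i + (((Real.sqrt (L : ℝ) - 1 : ℝ)) : ℂ) • chi (lev L (k + 1)) M i) := by
  have hd : 0 < d := Fin.pos i
  have hL : 1 ≤ L := Nat.pos_of_ne_zero (NeZero.ne L)
  have e : slabA (lev L k) M i = (slabA (lev L k) M i - chi (lev L k) M i) + chi (lev L k) M i := (sub_add_cancel _ _).symm
  rw [e, Matrix.mulVec_add, JnR_slabA_sub_chi, JnR_chi, sqrt_pow_pred_inv L hL hd]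
  push_cast
  rw [smul_sub, mul_smul, smul_add, smul_smul]
  funext y
  simp only [Pi.add_apply, Pi.sub_apply, Pi.smul_apply, smul_eq_mul]
  ring

end SlabTower

end Summit.QuantumFields.BalabanUV.T4Continuum.DirichletStarSlabLayer

end
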